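import Literature.Probability.LatticeModels.SourcedDoubleCurrents
import Literature.Probability.Percolation.LocalEvents
import HarnessLib

/-!
# The incipient infinite cluster (IIC) of the critical double random current on `ℤ^d`, `d ≥ 3`:
# the local limits `P^{x∞,∅}` and `P^{x₁∞,x₂∞}` of Panis (2025)

Topic `Probability/LatticeModels`; namespace `Literature.Probability.LatticeModels` (next to
`SourcedDoubleCurrents.lean`, whose infinite-volume sourced double current
`sourcedDoubleCurrentLawInf d β A B = P^{A,B}_β` — the law of the TRACE `n̂₁ ∪ n̂₂` of two independent
currents with source sets `A`, `B` — is the object sent to the limit here).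

## Source

R. Panis, *The incipient infinite cluster of the FK-Ising model in dimensions `d ≥ 3` and the
susceptibility of the high-dimensional Ising model*, Probab. Theory Relat. Fields **194** (2025)
2055–2097 [Panis2025] (arXiv:2406.15243), Theorem 3.1 ("The IIC measure of the random current"):

> Let `d ≥ 3` and `s ≥ 1`. Let `1 ≤ t ≤ s`. For all `x₁,…,x_t ∈ ℤ^d` there exists a measure
> `P^{x₁∞,…,x_t∞,∅,…,∅}` (where `∅` appears `s - t` times) on `Ω_{ℤ^d}` such that, for all local events
> `𝒜 ⊂ (Ω_{ℤ^d})^s`, `lim_{|y₁|,…,|y_t| → ∞} P_{β_c}^{x₁y₁,…,x_ty_t,∅,…,∅}[𝒜] = P^{x₁∞,…,x_t∞,∅,…,∅}[𝒜]`,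
> regardless of the manner in which `y₁,…,y_t` are sent to infinity.

(`P^{x₁y₁,…}_β` = the ADS15 weak limit of `P^{x₁y₁}_{Λ,β} ⊗ ⋯` as `Λ ↗ ℤ^d`, §2.1 there; the proof is
Panis' Thm 2.4, the `d ≥ 3` qualitative form of the Aizenman–Duminil-Copin mixing of currents.)
Its companion Thm 1.4 (`d > 4`) reads the susceptibility constant as
`A⁻¹ = 2dβ_c · P^{0∞,e₁∞}[C(0) ∩ C(e₁) = ∅]`, the probability that the two NEIGHBOURING incipient
infinite clusters avoid each other; §1.4.2 there: "`d = 4` is … the critical dimension for the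
intersection of two neighbouring random current IICs".

## What is defined (trace level, two currents: the cases `(s,t) = (2,1)` and `(2,2)` of Thm 3.1)

The tree realises infinite-volume double currents as laws of the trace of `n₁ + n₂` on
`BondConfig (Site d)` (`DoubleCurrentsInfinite.lean`, `SourcedDoubleCurrents.lean`); a trace-local event
(determined by finitely many bonds of `n̂₁ ∪ n̂₂`) is a local event of the pair `(n₁, n₂)` in Panis'
sense, so Thm 3.1 applies verbatim to it.  Accordingly:

* `IsCurrentIICLimit d x μ` — `μ` is `P^{x∞,∅}` read on the trace: a probability measure with
  `P^{{x}∆{y},∅}_{β_c}[S] → μ[S]` for every local `S` as `y → ∞` (cofinite filter of `ℤ^d`: "regardless of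
  the manner");
* `IsCurrentIICPairLimit d x₁ x₂ μ` — `μ` is `P^{x₁∞,x₂∞}` read on the trace: idem with
  `P^{{x₁}∆{y₁},{x₂}∆{y₂}}_{β_c}[S] → μ[S]` as `y₁, y₂ → ∞` jointly in any manner (product of cofinite
  filters);
* uniqueness of such limits (`.unique`, π-system of local events), the limits-by-choice
  `currentIICLaw d x`, `currentIICPairLaw d x₁ x₂` (junk `0` if no limit exists) and `.eq_law`;
* NAMED FACTS `currentIIC_limit_exists d`, `currentIICPair_limit_exists d` — Thm 3.1 for
  `(s,t) = (2,1)` and `(2,2)`, `d ≥ 3`, at trace level.  Users take `(h : currentIICPair_limit_exists d)`.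

NOT here: the second display of Thm 3.1 (the `χ(β)^{-t}`-weighted subcritical limit `β ↗ β_c`), its third
display (`x_i ↔ ∞` in `n_i` a.s.; at trace level only the weaker "`C_{n̂₁∪n̂₂}(x_i)` is infinite a.s."
would be expressible), Prop 3.2 (one-endedness, `P^{0∞,∅}[0 ↔ y] = ⟨σ₀σ_y⟩_{β_c}`, printed for `d ≥ 4`),
the FK-Ising IIC `φ^∞` (Thm 1.1) and the `d > 4` susceptibility theorems 1.3–1.4.  Sources written as
`{x} ∆ {y}` (the tree's convention for pair sources; `= {x, y}` once `y ≠ x`, which the limit ignores).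

## References

* R. Panis, PTRF 194 (2025), Thm 3.1; also Thms 1.4, 2.4, Def. 4.2 [Panis2025].
* M. Aizenman, H. Duminil-Copin, Ann. of Math. 194 (2021), §3.2, §6 [AizenmanDuminilCopinAnnals2021].
* M. Aizenman, H. Duminil-Copin, V. Sidoravicius, CMP 334 (2015), Thm 2.3
  [AizenmanDuminilCopinSidoraviciusCMP2015].
-/

noncomputable section

open _root_.MeasureTheory Filter _root_.Topology Finset Literature.Probability.Percolation
open scoped symmDiff

namespace Literature.Probability.LatticeModels

variable (d : ℕ)

/-! ### `P^{x∞,∅}`: one sourced current sent to infinity, one sourceless current -/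

/-- `μ` **is the IIC double current `P^{x∞,∅}`** of Panis (Thm 3.1 with `s = 2`, `t = 1`), read on the
trace `n̂₁ ∪ n̂₂`: a probability measure on bond configurations of `ℤ^d` such that for every local event
`S`, `P^{{x}∆{y},∅}_{β_c}[S] → μ[S]` as `y → ∞` in any manner (along the cofinite filter of `ℤ^d`).
[cite: Panis2025, Thm 3.1] -/
structure IsCurrentIICLimit (x : Site d) (μ : Measure (BondConfig (Site d))) : Prop where
  /-- `P^{x∞,∅}` is a probability measure. -/
  isProbabilityMeasure : IsProbabilityMeasure μ
  /-- Convergence on local events as the far source recedes. -/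
  tendsto_local : ∀ S : Set (BondConfig (Site d)), IsLocalEvent S →
    Tendsto (fun y : Site d => (sourcedDoubleCurrentLawInf d (criticalBeta d) ({x} ∆ {y}) ∅).real S)
      cofinite (𝓝 (μ.real S))

/-! ### `P^{x₁∞,x₂∞}`: two sourced currents sent to infinity (the neighbouring-IIC pair for `x₂ ∼ x₁`) -/

/-- `μ` **is the IIC double current `P^{x₁∞,x₂∞}`** of Panis (Thm 3.1 with `s = t = 2`), read on the
trace `n̂₁ ∪ n̂₂`: a probability measure on bond configurations of `ℤ^d` such that for every local event
`S`, `P^{{x₁}∆{y₁},{x₂}∆{y₂}}_{β_c}[S] → μ[S]` as `y₁, y₂ → ∞` jointly in any manner (product of the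
cofinite filters).  For `x₁ = 0`, `x₂ = e₁` this is the measure of Panis' Thm 1.4, under which "two
infinite structures emerge from two neighbouring points of `ℤ^d`". [cite: Panis2025, Thm 3.1] -/
structure IsCurrentIICPairLimit (x₁ x₂ : Site d) (μ : Measure (BondConfig (Site d))) : Prop where
  /-- `P^{x₁∞,x₂∞}` is a probability measure. -/
  isProbabilityMeasure : IsProbabilityMeasure μ
  /-- Convergence on local events as both far sources recede. -/
  tendsto_local : ∀ S : Set (BondConfig (Site d)), IsLocalEvent S →
    Tendsto (fun y : Site d × Site d =>
        (sourcedDoubleCurrentLawInf d (criticalBeta d) ({x₁} ∆ {y.1}) ({x₂} ∆ {y.2})).real S)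
      (cofinite ×ˢ cofinite) (𝓝 (μ.real S))

variable {d}

/-- `ℤ^d` is infinite for `d ≥ 1`, so its cofinite filter is proper. [folklore] -/
theorem cofinite_site_neBot (hd : 1 ≤ d) : (cofinite : Filter (Site d)).NeBot := by
  haveI : Nonempty (Fin d) := ⟨⟨0, hd⟩⟩
  haveI : Infinite (Site d) := Pi.infinite_of_right
  infer_instance

/-- **Uniqueness of `P^{x∞,∅}`** (`d ≥ 1`): two local limits coincide (local events form a π-system
generating the σ-algebra; limits along a proper filter are unique). [folklore] -/
theorem IsCurrentIICLimit.unique (hd : 1 ≤ d) {x : Site d} {μ ν : Measure (BondConfig (Site d))}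
    (hμ : IsCurrentIICLimit d x μ) (hν : IsCurrentIICLimit d x ν) : μ = ν := by
  haveI := hμ.isProbabilityMeasure
  haveI := hν.isProbabilityMeasure
  haveI := cofinite_site_neBot hd
  refine ext_of_isLocalEvent fun S hS => ?_
  have h := tendsto_nhds_unique (hμ.tendsto_local S hS) (hν.tendsto_local S hS)
  rw [measureReal_def, measureReal_def] at h
  exact (ENNReal.toReal_eq_toReal_iff' (measure_ne_top μ S) (measure_ne_top ν S)).1 h

/-- **Uniqueness of `P^{x₁∞,x₂∞}`** (`d ≥ 1`). [folklore] -/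
theorem IsCurrentIICPairLimit.unique (hd : 1 ≤ d) {x₁ x₂ : Site d} {μ ν : Measure (BondConfig (Site d))}
    (hμ : IsCurrentIICPairLimit d x₁ x₂ μ) (hν : IsCurrentIICPairLimit d x₁ x₂ ν) : μ = ν := by
  haveI := hμ.isProbabilityMeasure
  haveI := hν.isProbabilityMeasure
  haveI := cofinite_site_neBot hd
  refine ext_of_isLocalEvent fun S hS => ?_
  have h := tendsto_nhds_unique (hμ.tendsto_local S hS) (hν.tendsto_local S hS)
  rw [measureReal_def, measureReal_def] at h
  exact (ENNReal.toReal_eq_toReal_iff' (measure_ne_top μ S) (measure_ne_top ν S)).1 h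

variable (d)

open Classical in
/-- **The IIC double current `P^{x∞,∅}`** on `ℤ^d` (trace of `n₁ + n₂`): the local limit of
`P^{{x}∆{y},∅}_{β_c}` as `y → ∞` when it exists (Panis' Thm 3.1: it does for `d ≥ 3`, the named fact
`currentIIC_limit_exists`); **junk value** `0` otherwise. [cite: Panis2025, Thm 3.1] -/
def currentIICLaw (x : Site d) : Measure (BondConfig (Site d)) :=
  if h : ∃ μ, IsCurrentIICLimit d x μ then h.choose else 0

open Classical in
/-- **The IIC double current `P^{x₁∞,x₂∞}`** on `ℤ^d` (trace of `n₁ + n₂`): the local limit of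
`P^{{x₁}∆{y₁},{x₂}∆{y₂}}_{β_c}` as `y₁, y₂ → ∞` when it exists (Panis' Thm 3.1: it does for `d ≥ 3`, the
named fact `currentIICPair_limit_exists`); **junk value** `0` otherwise.  `currentIICPairLaw d 0 e₁` is
the measure of Panis' Thm 1.4. [cite: Panis2025, Thm 3.1] -/
def currentIICPairLaw (x₁ x₂ : Site d) : Measure (BondConfig (Site d)) :=
  if h : ∃ μ, IsCurrentIICPairLimit d x₁ x₂ μ then h.choose else 0

variable {d}

/-- If a local limit `P^{x∞,∅}` exists, `currentIICLaw` is one. [folklore] -/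
theorem isCurrentIICLimit_law {x : Site d} (h : ∃ μ, IsCurrentIICLimit d x μ) :
    IsCurrentIICLimit d x (currentIICLaw d x) := by
  rw [currentIICLaw, dif_pos h]
  exact h.choose_spec

/-- If a local limit `P^{x₁∞,x₂∞}` exists, `currentIICPairLaw` is one. [folklore] -/
theorem isCurrentIICPairLimit_law {x₁ x₂ : Site d} (h : ∃ μ, IsCurrentIICPairLimit d x₁ x₂ μ) :
    IsCurrentIICPairLimit d x₁ x₂ (currentIICPairLaw d x₁ x₂) := by
  rw [currentIICPairLaw, dif_pos h]
  exact h.choose_spec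

/-- Hence (`d ≥ 1`) any local limit `P^{x∞,∅}` **is** `currentIICLaw d x`. [folklore] -/
theorem IsCurrentIICLimit.eq_law (hd : 1 ≤ d) {x : Site d} {μ : Measure (BondConfig (Site d))}
    (hμ : IsCurrentIICLimit d x μ) : μ = currentIICLaw d x :=
  hμ.unique hd (isCurrentIICLimit_law ⟨μ, hμ⟩)

/-- Hence (`d ≥ 1`) any local limit `P^{x₁∞,x₂∞}` **is** `currentIICPairLaw d x₁ x₂`. [folklore] -/
theorem IsCurrentIICPairLimit.eq_law (hd : 1 ≤ d) {x₁ x₂ : Site d} {μ : Measure (BondConfig (Site d))}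
    (hμ : IsCurrentIICPairLimit d x₁ x₂ μ) : μ = currentIICPairLaw d x₁ x₂ :=
  hμ.unique hd (isCurrentIICPairLimit_law ⟨μ, hμ⟩)

/-- When no local limit exists the law is the junk value `0`. [folklore] -/
theorem currentIICPairLaw_of_not_exists {x₁ x₂ : Site d} (h : ¬ ∃ μ, IsCurrentIICPairLimit d x₁ x₂ μ) :
    currentIICPairLaw d x₁ x₂ = 0 := by
  rw [currentIICPairLaw, dif_neg h]

/-- When no local limit exists the law is the junk value `0`. [folklore] -/
theorem currentIICLaw_of_not_exists {x : Site d} (h : ¬ ∃ μ, IsCurrentIICLimit d x μ) :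
    currentIICLaw d x = 0 := by
  rw [currentIICLaw, dif_neg h]

variable (d)

/-- NAMED FACT — **existence of the IIC double current `P^{x∞,∅}`** (Panis 2025, Thm 3.1 with `s = 2`,
`t = 1`: "Let `d ≥ 3` … For all `x₁,…,x_t ∈ ℤ^d` there exists a measure `P^{x₁∞,…,x_t∞,∅,…,∅}` … such
that, for all local events `𝒜`, `lim_{|y₁|,…,|y_t|→∞} P_{β_c}^{x₁y₁,…,x_ty_t,∅,…,∅}[𝒜] = P^{x₁∞,…}[𝒜]`,
regardless of the manner in which `y₁,…,y_t` are sent to infinity").  Formal reading: nearest-neighbour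
Ising model on `ℤ^d`, `d ≥ 3`, at `β_c(d)`; the infinite-volume double current `P^{{x}∆{y},∅}_{β_c}` is the
tree's `sourcedDoubleCurrentLawInf d (criticalBeta d) ({x} ∆ {y}) ∅` (law of the trace of `n₁ + n₂`, free
boundary condition along boxes — the ADS15 weak limit of §2.1 there), local events = events determined by
finitely many bonds of the trace (a sub-class of Panis' local events of the pair), "regardless of the
manner" = the cofinite filter of `ℤ^d`.  Users take `(h : currentIIC_limit_exists d)`. [cite: Panis2025, Thm 3.1] -/
def currentIIC_limit_exists : Prop :=
  3 ≤ d → ∀ x : Site d, ∃ μ, IsCurrentIICLimit d x μ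

/-- NAMED FACT — **existence of the IIC pair double current `P^{x₁∞,x₂∞}`** (Panis 2025, Thm 3.1 with
`s = t = 2`, quoted under `currentIIC_limit_exists`; for `(x₁,x₂) = (0,e₁)` the measure of Thm 1.4 there,
"two infinite structures emerge from two neighbouring points of `ℤ^d`").  Formal reading: nearest-neighbour
Ising model on `ℤ^d`, `d ≥ 3`, at `β_c(d)`; `P^{{x₁}∆{y₁},{x₂}∆{y₂}}_{β_c}` is the tree's
`sourcedDoubleCurrentLawInf d (criticalBeta d) ({x₁} ∆ {y₁}) ({x₂} ∆ {y₂})` (trace of `n₁ + n₂`); local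
events = events determined by finitely many bonds of the trace; "`|y₁|, |y₂| → ∞` regardless of the
manner" = the product of the cofinite filters of `ℤ^d`.  Users take `(h : currentIICPair_limit_exists d)`.
[cite: Panis2025, Thm 3.1] -/
def currentIICPair_limit_exists : Prop :=
  3 ≤ d → ∀ x₁ x₂ : Site d, ∃ μ, IsCurrentIICPairLimit d x₁ x₂ μ

variable {d}

/-- Under the fact, `P^{x∞,∅}` is a probability measure and `P^{{x}∆{y},∅}_{β_c}[S] → P^{x∞,∅}[S]` on local
events. [cite: Panis2025, Thm 3.1] -/
theorem currentIIC_limit_exists.isLimit (h : currentIIC_limit_exists d) (hd : 3 ≤ d) (x : Site d) :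
    IsCurrentIICLimit d x (currentIICLaw d x) :=
  isCurrentIICLimit_law (h hd x)

/-- Under the fact, `P^{x₁∞,x₂∞}` is a probability measure and
`P^{{x₁}∆{y₁},{x₂}∆{y₂}}_{β_c}[S] → P^{x₁∞,x₂∞}[S]` on local events. [cite: Panis2025, Thm 3.1] -/
theorem currentIICPair_limit_exists.isLimit (h : currentIICPair_limit_exists d) (hd : 3 ≤ d)
    (x₁ x₂ : Site d) : IsCurrentIICPairLimit d x₁ x₂ (currentIICPairLaw d x₁ x₂) :=
  isCurrentIICPairLimit_law (h hd x₁ x₂)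

end Literature.Probability.LatticeModels

end
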